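import Literature.NumberTheory.Sieve.CFSemigroupBoundary
import Literature.NumberTheory.Sieve.CFSemigroupCongruence
import HarnessLib

/-!
# The congruence (twisted) transfer operator of `Γ_A` on `SL₂(ℤ/qℤ) → CfLip`

Support file (all results proved) for the named fact
`Literature.NumberTheory.Sieve.MageeOhWinter2019_uniformCounting` (`CFSemigroupCounting.lean`).
[MageeOhWinter2019, §3.2, eq. (3.4)] ("the congruence renewal equation at level `q`"): counting
in a residue class `ξ ∈ Γ_q = SL₂(ℤ/qℤ)` is governed by the transfer operator twisted by the
reduction cocycle, acting on `Γ_q`-indexed families of functions. Since `Γ_A` consists of EVEN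
words (single generators `g_a` have determinant `-1`), we twist the PAIR operators: on the Banach
space `SL₂(ℤ/qℤ) → CfLip` (sup norm),
`(𝓜_{s,q} F)_ξ = Σ_{a,b ∈ A} L_{s,(a,b)} F_{ξ π_q(g_a g_b)⁻¹}`, `(L_{s,(a,b)} G)(x) = d(x)^{-2s} G(g_a g_b x)`.

* `cfLOp1`: the single-letter operator `G ↦ (x+a)^{-2s} G(1/(x+a))` on `CfLip`, `cfLOp_eq_sum`;
* `cfPairOp a b = L_b ∘ L_a` with `cfPairOp_apply` (weight and branch of the matrix `g_a g_b`),
  `sum_cfPairOp : Σ_{a,b} cfPairOp = L_s²`;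
* `cfTwist`: the twisted operator as a continuous linear map (`ContinuousLinearMap.pi`),
  `cfTwist_apply`, `cfTwist_const` (on `ξ`-constant families it is `L_s²`), and
  `sum_cfTwist_apply` (`Σ_ξ (𝓜F)_ξ = L_s² (Σ_ξ F_ξ)`: the averaged eigenfunctional is invariant).
  [cite: MageeOhWinter2019, §3.2]

## References

* M. Magee, H. Oh, D. Winter, J. reine angew. Math. 753 (2019) 89–135, §3.2. [MageeOhWinter2019]
-/

noncomputable section

open Set Filter
open scoped MatrixGroups

namespace Literature.NumberTheory.Sieve

variable {A : Finset ℕ}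

/-! ### Single letters and pairs -/

/-- The single-letter transfer operator `G ↦ (x+a)^{-2s} G(1/(x+a))` on `CfLip` (`a ≥ 1`). [folklore] -/
def cfLOp1 {a : ℕ} (ha : 1 ≤ a) (s : ℂ) : CfLip →L[ℂ] CfLip :=
  cfLOp {a} (fun a' h => by rw [Finset.mem_singleton] at h; rw [h]; exact ha) s

/-- Pointwise formula for the single-letter operator. [folklore] -/
@[simp] theorem cfLOp1_apply {a : ℕ} (ha : 1 ≤ a) (s : ℂ) (G : CfLip) (x : Icc (0 : ℝ) 1) :
    cfLOp1 ha s G x = cfWt s (cfGen a) x * G.extend (1 / (x + a)) := by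
  rw [cfLOp1, cfLOp_apply, cfLC, Finset.sum_singleton]

/-- `L_s = Σ_a L_{s,a}`. [folklore] -/
theorem cfLOp_eq_sum (hA : ∀ a ∈ A, 1 ≤ a) (s : ℂ) :
    cfLOp A hA s = ∑ a ∈ A.attach, cfLOp1 (hA a a.2) s := by
  refine ContinuousLinearMap.ext fun G => DFunLike.ext _ _ fun x => ?_
  rw [cfLOp_apply, cfLC, _root_.sum_apply, CfLip.finset_sum_apply]
  simp only [cfLOp1_apply]
  exact (Finset.sum_attach A fun a => cfWt s (cfGen a) x * G.extend (1 / (x + a))).symm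

/-- **The pair operator** `L_{s,(a,b)} = L_{s,b} ∘ L_{s,a}`: `G ↦ d(x)^{-2s} G(g_a g_b x)` for the
matrix `g_a g_b ∈ Γ_A`. [cite: MageeOhWinter2019, §3.2] -/
def cfPairOp {a b : ℕ} (ha : 1 ≤ a) (hb : 1 ≤ b) (s : ℂ) : CfLip →L[ℂ] CfLip := cfLOp1 hb s * cfLOp1 ha s

/-- **Pointwise formula for the pair operator:** weight and branch of the matrix `g_a g_b`.
[cite: MageeOhWinter2019, §3.2] -/
theorem cfPairOp_apply {a b : ℕ} (ha : 1 ≤ a) (hb : 1 ≤ b) (s : ℂ) (G : CfLip) (x : Icc (0 : ℝ) 1) :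
    cfPairOp ha hb s G x = cfWt s (cfGen a * cfGen b) x * G.extend (cfMoeb (cfGen a * cfGen b) x) := by
  have hb1 : (1 : ℝ) ≤ b := by exact_mod_cast hb
  have ha1 : (1 : ℝ) ≤ a := by exact_mod_cast ha
  have hxb : 0 < cfDenom (cfGen b) x := by rw [cfDenom_cfGen]; linarith [x.2.1]
  have hy : cfMoeb (cfGen b) x ∈ Icc (0 : ℝ) 1 := by rw [cfMoeb_cfGen]; exact one_div_add_mem_Icc hb x.2
  have hya : 0 < cfDenom (cfGen a) (cfMoeb (cfGen b) x) := by rw [cfDenom_cfGen]; linarith [hy.1]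
  rw [cfPairOp, ContinuousLinearMap.mul_def, ContinuousLinearMap.coe_comp, Function.comp_apply, cfLOp1_apply,
    CfLip.extend_of_mem _ (one_div_add_mem_Icc hb x.2), cfLOp1_apply, cfWt_mul s _ _ hxb hya,
    cfMoeb_mul _ _ hxb.ne' hya.ne', cfMoeb_cfGen, cfMoeb_cfGen]
  simp only [one_div]
  ring

/-- **`Σ_{a,b} L_{s,(a,b)} = L_s²`.** [folklore] -/
theorem sum_cfPairOp (hA : ∀ a ∈ A, 1 ≤ a) (s : ℂ) :
    ∑ a ∈ A.attach, ∑ b ∈ A.attach, cfPairOp (hA a a.2) (hA b b.2) s = cfLOp A hA s ^ 2 := by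
  rw [sq, cfLOp_eq_sum hA s, Finset.sum_mul_sum, Finset.sum_comm]
  rfl

/-! ### The twisted operator -/

section Twist

variable (A) (hA : ∀ a ∈ A, 1 ≤ a) (q : ℕ)
include hA

/-- The twist `σ_{(a,b)} = π_q(g_a g_b)⁻¹ ∈ SL₂(ℤ/qℤ)` (right multiplication). [cite: MageeOhWinter2019, §3.2] -/
def cfSigma (a b : ℕ) : SL(2, ZMod q) := (cfRed q (cfPair a b))⁻¹

/-- **The congruence transfer operator** `(𝓜 F)_ξ = Σ_{a,b} L_{s,(a,b)} F_{ξ σ_{(a,b)}}` on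
`SL₂(ℤ/qℤ) → CfLip`. [cite: MageeOhWinter2019, §3.2 eq. (3.4)] -/
def cfTwist (s : ℂ) : (SL(2, ZMod q) → CfLip) →L[ℂ] (SL(2, ZMod q) → CfLip) :=
  ContinuousLinearMap.pi fun ξ =>
    ∑ a ∈ A.attach, ∑ b ∈ A.attach,
      (cfPairOp (hA a a.2) (hA b b.2) s).comp (ContinuousLinearMap.proj (ξ * cfSigma q a b))

/-- Componentwise formula for the twisted operator. [cite: MageeOhWinter2019, §3.2] -/
theorem cfTwist_apply (s : ℂ) (F : SL(2, ZMod q) → CfLip) (ξ : SL(2, ZMod q)) :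
    cfTwist A hA q s F ξ =
      ∑ a ∈ A.attach, ∑ b ∈ A.attach, cfPairOp (hA a a.2) (hA b b.2) s (F (ξ * cfSigma q a b)) := by
  simp only [cfTwist, ContinuousLinearMap.pi_apply, _root_.sum_apply, ContinuousLinearMap.coe_comp,
    Function.comp_apply, ContinuousLinearMap.proj_apply]

/-- **Untwisting on constant families:** `𝓜 (ξ ↦ G) = (ξ ↦ L_s² G)`. [cite: MageeOhWinter2019, §3.2] -/
theorem cfTwist_const (s : ℂ) (G : CfLip) (ξ : SL(2, ZMod q)) :
    cfTwist A hA q s (fun _ => G) ξ = (cfLOp A hA s ^ 2) G := by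
  rw [cfTwist_apply, ← sum_cfPairOp hA s, _root_.sum_apply]
  exact Finset.sum_congr rfl fun a _ => by rw [_root_.sum_apply]

/-- **Invariance of the average:** `Σ_ξ (𝓜F)_ξ = L_s² (Σ_ξ F_ξ)` (each `ξ ↦ ξ σ` is a bijection), so
the functional `F ↦ |Γ_q|⁻¹ Σ_ξ ν(F_ξ)` is `𝓜_{δ,q}`-invariant. [cite: MageeOhWinter2019, §3.2] -/
theorem sum_cfTwist_apply [NeZero q] (s : ℂ) (F : SL(2, ZMod q) → CfLip) :
    ∑ ξ, cfTwist A hA q s F ξ = (cfLOp A hA s ^ 2) (∑ ξ, F ξ) := by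
  simp_rw [cfTwist_apply]
  rw [Finset.sum_comm, ← sum_cfPairOp hA s, _root_.sum_apply]
  refine Finset.sum_congr rfl fun a _ => ?_
  rw [Finset.sum_comm, _root_.sum_apply]
  refine Finset.sum_congr rfl fun b _ => ?_
  rw [← map_sum]
  congr 1
  exact Fintype.sum_equiv (Equiv.mulRight (cfSigma q a b)) _ _ fun ξ => rfl

end Twist

end Literature.NumberTheory.Sieve
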